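import Summits.QuantumFields.YangMills.Theorems.AlphaInputsT3ACv3
import Summits.QuantumFields.YangMills.Theorems.BalabanUVNodesN08AlphaArgClass
import Summits.QuantumFields.YangMills.Theorems.BalabanUVNodesN08AlphaCompactSel
import Summits.QuantumFields.YangMills.Theorems.BalabanUVNodesN08AlphaClassIDischarge
import Summits.QuantumFields.BalabanUV.T4Continuum.Support.SubstrateBlockAvgContinuity
import HarnessLib

/-!
# `AlphaInputsT3ACv3AdaptedClass` — STRATEGY B for 2′ (owner AMENDMENT (4′), design note `STRATEGY-B-adapted-class-T3-alpha1-g5.md` §B.2):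
# THE ADAPTED CLASS `𝒞(k, h, W)` of the composite-minimiser problem AT THE T³∕AC OBJECTS, in the compact configuration space
# `GaugeField (F.P K) 0 SU(2)` — closed, with minimisers by compactness and a MEASURABLE argmin selector — lane `pub-balaban3d`, seat alpha-2 (g0)

WHAT.  NODE O's class-I device (`BalabanUVNodesN08AlphaAdaptedSel`: the (42)-minimiser selected INSIDE an adapted closed class, so that the
in-edge rows hold BY MEMBERSHIP) re-run in the currency of the v3 socket `AlphaInputsT3AC.OfV3At` (`AlphaInputsT3ACv3`): the rows r2 (42)-top and r3
(68)-multi-level of `MinimiserRowsT3` read the family's averaging `Averaging.iter (blockAvg ℰp)`, the rows `hLF67`∕`h68` of `AlphaV3AC.RunAlphaV3AC` read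
the lifted [4]-averages `avgIter L (liftCfg 𝔊 ·)`; both averagings are continuous only on small-loop classes, so the class is cut by BOTH adapted classes:
* `NestedSmall ℰp (δ/2) k` (tree `SubstrateBlockAvgContinuity`: the (0.4) loop variables of every level `< k` within `δ/2`; on it `(blockAvg ℰp)^s`,
  `s ≤ k`, is continuous) and NODE O's `argClassC 𝔊 k` (iterated `log`-arguments `≤ ¼`; on it every lifted `j`-fold average, `j < k`, is continuous);
* NODE O's closed regular class `regClassC 𝔊 𝔠 k h` ([7] (2)∕(8) at half the constant — gives `h68`, sibling file);
* the (67)-LARGENESS set `large67Set` (the row `hLF67`'s text on the configuration itself — §B.6's `Large67`, instantiated with the v3 [B7] letters);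
* and, GUARDED by the datum's window `ChargedT3 … k h W` (an OPEN condition on `W`), the top constraint (42) «`(blockAvg ℰp)^k Ũ = W` on the bonds of
  `Ω_k(h)`» together with r3's multi-level regularity text.
All conditions are closed (`≤`, `=`) on the closed class where the maps are continuous; `SU(2)^{bonds}` is compact.  CONTENTS: §1 a closed-class reading of
the tree's selection theorem `exists_measurable_constrained_argmin` (measurable argmin over `{y ∈ C | (g y, π x) ∈ R}`, `C` closed, `g` continuous ON `C`; minimisers by
compactness); §2 the sets and the class; §3 topology: `|·−1|`, `Re tr`, the Wilson action are continuous on `SU(2)^{bonds}`, the small-loop class is closed and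
`(blockAvg ℰp)^s` continuous on it, the (67)-set ∕ r3-set are closed relative to the respective small-loop classes, the window `ChargedT3` is OPEN, the
W-independent core of the class is closed.  The selector itself and «membership ⇒ rows» are the sibling `AlphaInputsT3ACv3AdaptedSel`.

HONEST FRAMING.  Kinematics∕topology only; nothing of [B10]∕[7]∕[4]'s estimates is asserted; the class is NOT claimed to contain print's (42)-minimiser,
and its NON-EMPTINESS is NOT proved here (it is the displayed row (D6) of `DataSchemaT3AC`, sibling file).  Count-neutral helper toward R3 2′
(`stub_laneRecordsV3`, items 19935∕19936); nothing here is a claim about d = 4, the continuum, or a mass gap.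

References: T. Bałaban, Commun. Math. Phys. 102 (1985) 255–275 [Balaban1985UV3] ((40)–(42) p.266, (67)–(68) p.273); CMP 102 (1985) 277–309
[Balaban1985Variational] (Thm 1 (8) p.279); CMP 98 (1985) 17–51 [Balaban1985Averaging] ((21) p.21, (42)–(43) pp.23–24); C. D. Aliprantis,
K. C. Border, Infinite Dimensional Analysis (2006) Thm 18.19 [AliprantisBorder2006].
-/

set_option autoImplicit false

noncomputable section

namespace Summit.QuantumFields.YangMills.Theorems

open MeasureTheory Set Topology TopologicalSpace
open scoped Matrix Matrix.Norms.L2Operator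
open Literature.MeasureTheory.RandomSets
open Literature.MathematicalPhysics.QuantumFieldTheory.Balaban1983to89
open Literature.MathematicalPhysics.QuantumFieldTheory.Balaban1983to89.B10 (pFun)
open Literature.MathematicalPhysics.QuantumFieldTheory.Balaban1983to89.T3ContinuumYM3Torus
open Literature.MathematicalPhysics.QuantumFieldTheory.Balaban1983to89.T3UnitLawDensityEML (ℰp)
open Literature.MathematicalPhysics.QuantumFieldTheory.Balaban1983to89.T3UnitScaleTilt (θBal)
open Literature.MathematicalPhysics.QuantumFieldTheory.Balaban1983to89.B10Eq38TorusDomains (plaqsIn)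
open Literature.MathematicalPhysics.QuantumFieldTheory.Balaban1983to89.B10Eq42TorusConstraint (bondsIn lam42)
open Literature.MathematicalPhysics.QuantumFieldTheory.Balaban1983to89.B10Eq70Squaring (deltaBox)
open Literature.MathematicalPhysics.QuantumFieldTheory.Balaban1985CMP102.Setting
open Summit.QuantumFields.Balaban3D.Carriers
open Summit.QuantumFields.Balaban3D.Proofs.Primitives (AlphaConsts)
open Summit.QuantumFields.Balaban3D.Proofs.LiftBridge (liftCfg)
open Summit.QuantumFields.Balaban3D.Proofs.TorusLift (projSite zOf projSite_mem_plaqCover)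
open Summit.QuantumFields.Balaban3D.Proofs.AdmissibleRegions (plaqCover_subset_of_admissible)
open Summit.QuantumFields.Balaban3D.Proofs.Run3SmallFactors (codeZ decode_of_mem_disc)
open Summit.QuantumFields.Balaban3D.Proofs.ScalesArithmetic (gk_pos gk_le_one)
open Summit.QuantumFields.Balaban3D.Proofs.CouplingWindow (pFun_pos)
open Summit.QuantumFields.BalabanUV.T4Continuum.SubstrateBlockAvgContinuity (NestedSmall isClosed_nestedSmall continuousOn_iter_blockAvg
  nestedSmall_succ_subset smallContinuous_expMeanLogSU one_mem_nestedSmall_expMeanLogSU)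
open Summit.QuantumFields.YangMills.Theorems.BalabanUVNodesN08AlphaGroupTopology
open Summit.QuantumFields.YangMills.Theorems.BalabanUVNodesN08AlphaLiftAvgCont (continuousAt_val_hol)
open Summit.QuantumFields.YangMills.Theorems.BalabanUVNodesN08AlphaArgClass
open Summit.QuantumFields.YangMills.Theorems.BalabanUVNodesN08AlphaRegSel (regClass)
open Summit.QuantumFields.YangMills.Theorems.BalabanUVNodesN08AlphaCompactSel (regClassC isClosed_regClassC regClassC_subset_regClass one_mem_regClassC)
open Summit.QuantumFields.YangMills.Theorems.BalabanUVNodesN08AlphaClassI (RegLift)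
open Summit.QuantumFields.YangMills.Theorems.BalabanUVNodesN08AlphaClassIDischarge (mem_deltaBox_of_inBox)
open B7Prop1Explicit (hol plaqWord)
open B7Prop1Local (pdevOn loK plaqHiK InBox hol_plaqWord_eq)
open B7Prop2Explicit (avgIter hol_plaqWord_self)
open B8Ineq132 (pdevOn_lt_of_forall)

/-! ## §1 Measurable argmin over a CLOSED class cut by a closed constraint (closed-class reading of the tree's selection theorem) -/

section ClosedSelection

variable {X Y Z : Type*} [MeasurableSpace X] [TopologicalSpace Y] [PolishSpace Y] [CompactSpace Y] [MeasurableSpace Y] [BorelSpace Y]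
  [TopologicalSpace Z] [MeasurableSpace Z] [OpensMeasurableSpace Z]

open Classical in
/-- **MEASURABLE SELECTION OF CONSTRAINED MINIMISERS OVER A CLOSED CLASS.**  `Y` compact Polish (Borel), `C ⊆ Y` CLOSED, `g : Y → Z` continuous ON `C`,
`R ⊆ Z × Z` closed, `π : X → Z` measurable, `S` continuous.  For the admissible sets `A(x) = {y ∈ C | (g y, π x) ∈ R}`: (i) a measurable `f` with
`f x ∈ argmin_{A(x)} S` wherever a minimiser exists and `f x = y₀` elsewhere; (ii) a minimiser EXISTS as soon as `A(x) ≠ ∅` (`A(x)` is closed in the compact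
`Y`).  Reduction to the tree's open-class theorem `exists_measurable_constrained_argmin` (`O = univ`): patch `g` by a constant off `C` (σ-closed-continuous by
`SigmaClosedContinuous.of_isOpen` at `Cᶜ`) and carry «`y ∈ C`» as a second coordinate of the constraint. [cite: AliprantisBorder2006, Thm 18.19 p.605] -/
theorem exists_measurable_argmin_closedClass {π : X → Z} (hπ : Measurable π) {C : Set Y} (hC : IsClosed C) {g : Y → Z}
    (hg : ContinuousOn g C) {R : Set (Z × Z)} (hR : IsClosed R) {S : Y → ℝ} (hS : Continuous S) (y₀ : Y) :
    (∃ f : X → Y, Measurable f ∧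
      (∀ x, (∃ y ∈ {y | y ∈ C ∧ (g y, π x) ∈ R}, IsMinOn S {y | y ∈ C ∧ (g y, π x) ∈ R} y) →
        f x ∈ {y | y ∈ C ∧ (g y, π x) ∈ R} ∧ IsMinOn S {y | y ∈ C ∧ (g y, π x) ∈ R} (f x)) ∧
      (∀ x, ¬ (∃ y ∈ {y | y ∈ C ∧ (g y, π x) ∈ R}, IsMinOn S {y | y ∈ C ∧ (g y, π x) ∈ R} y) → f x = y₀)) ∧
    (∀ x, {y | y ∈ C ∧ (g y, π x) ∈ R}.Nonempty → ∃ y ∈ {y | y ∈ C ∧ (g y, π x) ∈ R}, IsMinOn S {y | y ∈ C ∧ (g y, π x) ∈ R} y) := by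
  letI : MetrizableSpace Y := inferInstance
  -- the patched constraint map, with the point itself as a second coordinate
  let g' : Y → Z × Y := fun y => (C.piecewise g (fun _ => g y₀) y, y)
  let π' : X → Z × Y := fun x => (π x, y₀)
  let R' : Set ((Z × Y) × (Z × Y)) := {p | (p.1.1, p.2.1) ∈ R ∧ p.1.2 ∈ C}
  have hg' : SigmaClosedContinuous g' := by
    refine SigmaClosedContinuous.of_isOpen hC.isOpen_compl ?_ ?_
    · exact (continuousOn_const.congr (Set.piecewise_eqOn_compl C g _)).prodMk continuousOn_id
    · rw [compl_compl]
      exact (hg.congr (Set.piecewise_eqOn C g _)).prodMk continuousOn_id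
  have hπ' : Measurable π' := hπ.prodMk measurable_const
  have hR' : IsClosed R' :=
    (hR.preimage ((continuous_fst.comp continuous_fst).prodMk (continuous_fst.comp continuous_snd))).inter
      (hC.preimage (continuous_snd.comp continuous_fst))
  have hiff : ∀ (y : Y) (x : X), (y ∈ (univ : Set Y) ∧ (g' y, π' x) ∈ R') ↔ (y ∈ C ∧ (g y, π x) ∈ R) := by
    intro y x
    simp only [mem_univ, true_and, R', g', π', mem_setOf_eq]
    constructor
    · rintro ⟨h, hy⟩
      exact ⟨hy, by rwa [Set.piecewise_eq_of_mem _ _ _ hy] at h⟩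
    · rintro ⟨hy, h⟩
      exact ⟨by rwa [Set.piecewise_eq_of_mem _ _ _ hy], hy⟩
  obtain ⟨f, hfm, hfin, hfout⟩ := exists_measurable_constrained_argmin hπ' hg' isOpen_univ hR' hS y₀
  refine ⟨⟨f, hfm, fun x hx => ?_, fun x hx => ?_⟩, fun x hne => ?_⟩
  · obtain ⟨y, hy, hmin⟩ := hx
    have hex := hfin x ⟨y, (hiff y x).mpr hy, fun z hz => hmin ((hiff z x).mp hz)⟩
    exact ⟨(hiff _ x).mp hex.1, fun z hz => hex.2 z ((hiff z x).mpr hz)⟩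
  · refine hfout x fun h => hx ?_
    obtain ⟨y, hy, hmin⟩ := h
    exact ⟨y, (hiff y x).mp hy, fun z hz => hmin z ((hiff z x).mpr hz)⟩
  · exact (isCompact_constraint hC hg hR (π x)).exists_isMinOn hne hS.continuousOn

end ClosedSelection

/-! ## §2 The adapted class at the T³ objects -/

section T3

variable (F : T3Family) (𝔠 : AlphaConsts F.L (suGroupModel 2).N) (γ : ℝ) (hγ : 0 < γ) (hγ1 : γ ≤ (min 𝔠.gamma0 1) ^ 2) (K : ℕ)

/-- **THE (67)-LARGENESS SET OF A HISTORY** (design note §B.6's `Large67`, instantiated with the v3 row's [B7] letters): configurations `Ũ` of the finest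
lattice whose lifted `j`-fold [4]-average has, at every recorded large-field plaquette `(j, p′) ∈ P(h)`, holonomy at distance `≥ g_jp(g_j)` from `1` — the
text of `AlphaV3AC.RunAlphaV3AC.hLF67` read on the configuration itself. [cite: Balaban1985UV3, (67) p.273] -/
def AlphaInputsT3AC.large67Set (k : ℕ) (h : Hist (F.P K) k) : Set (GaugeField (F.P K) 0 (Matrix.specialUnitaryGroup (Fin 2) ℂ)) :=
  {U | ∀ e ∈ Hist.disc h,
    (T3Scales F γ hγ (hγ1.trans (sq_min_one_le _ 𝔠.gamma0_pos)) K).gk e.1 *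
        pFun 𝔠.lane.carrier.b₀ 𝔠.lane.carrier.p₀ ((T3Scales F γ hγ (hγ1.trans (sq_min_one_le _ 𝔠.gamma0_pos)) K).gk e.1) ≤
      ‖((hol (avgIter F.L (liftCfg (S := T3Scales F γ hγ (hγ1.trans (sq_min_one_le _ 𝔠.gamma0_pos)) K) (suGroupModel 2) U) e.1)
          (codeZ e) (plaqWord e.2.2.1 e.2.2.2) : (Matrix (Fin (suGroupModel 2).N) (Fin (suGroupModel 2).N) ℂ)ˣ) :
          Matrix (Fin (suGroupModel 2).N) (Fin (suGroupModel 2).N) ℂ) - 1‖}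

/-- **THE (68) MULTI-LEVEL REGULARITY SET** (the text of `MinimiserRowsT3`'s row r3 read on the configuration): for `i ≤ k`, `s ≤ i`, every level-`s`
plaquette under `Λ_i(h)` of the `s`-fold `blockAvg ℰp`-average of `Ũ` is within `C68·θBal(K − i)·L^{−2(i−s)}` of `1`. [cite: Balaban1985UV3, (68) p.273] -/
def AlphaInputsT3AC.reg68LevelsSet (k : ℕ) (h : Hist (F.P K) k) : Set (GaugeField (F.P K) 0 (Matrix.specialUnitaryGroup (Fin 2) ℂ)) :=
  {U | ∀ i, i ≤ k → ∀ s, s ≤ i → ∀ q : Plaq (F.P K) s,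
    q ∈ plaqsIn s (lam42 (Omega 𝔠.lane.carrier.M₁
      (rcolOf (T3Scales F γ hγ (hγ1.trans (sq_min_one_le _ 𝔠.gamma0_pos)) K) 𝔠.lane.carrier) k h) k i) →
    GaugeGroup.dist1 (GaugeField.plaqHol
        (Averaging.iter (fun l => BlockAveraging.blockAvg (P := F.P K) (j := l) ℰp) s U) q) ≤
      𝔠.C68 * θBal F.L γ 𝔠.b₀ 𝔠.p₀ (K - i) * (((F.L : ℝ) ^ (i - s))⁻¹) ^ 2}

/-- **THE (42) TOP-CONSTRAINT SET OF A DATUM** (the text of `MinimiserRowsT3`'s row r2): the `k`-fold `blockAvg ℰp`-average of `Ũ` equals `W` on the bonds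
of `T^{(k)}` inside `Ω_k(h)` («Ū_k^k = V_k = V on Λ_k»). [cite: Balaban1985UV3, (42) p.266] -/
def AlphaInputsT3AC.top42Set (k : ℕ) (h : Hist (F.P K) k) (W : GaugeField (F.P K) k (Matrix.specialUnitaryGroup (Fin 2) ℂ)) :
    Set (GaugeField (F.P K) 0 (Matrix.specialUnitaryGroup (Fin 2) ℂ)) :=
  {U | ∀ b : PBond (F.P K) k, b ∈ bondsIn k (Omega 𝔠.lane.carrier.M₁
      (rcolOf (T3Scales F γ hγ (hγ1.trans (sq_min_one_le _ 𝔠.gamma0_pos)) K) 𝔠.lane.carrier) k h k) →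
    Averaging.iter (fun i => BlockAveraging.blockAvg (P := F.P K) (j := i) ℰp) k U b = W b}

/-- **THE ADAPTED CLASS `𝒞(k, h, W)`** (design note §B.2): the finest-lattice configurations in the two small-loop classes (`NestedSmall ℰp (δ/2) k` for the
family's averaging, NODE O's `argClassC` for the lifted [4]-averages), in [7]'s closed regular class `regClassC` ((68) at half the constant), (67)-large at the
history's recorded plaquettes, and — when the datum is CHARGED (`ChargedT3`, the window on which (42)–(46), (67)–(68) are derived, p.267 l.1–3) — satisfying the
top constraint (42) and the multi-level regularity r3.  A CLOSED subset of the compact `SU(2)^{bonds}` (`isClosed_adaptedClassT3`). [cite: Balaban1985UV3, (42) p.266 + (67)–(68) p.273] -/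
def AlphaInputsT3AC.adaptedClassT3 (k : ℕ) (h : Hist (F.P K) k) (W : GaugeField (F.P K) k (Matrix.specialUnitaryGroup (Fin 2) ℂ)) :
    Set (GaugeField (F.P K) 0 (Matrix.specialUnitaryGroup (Fin 2) ℂ)) :=
  {U | U ∈ NestedSmall (P := F.P K) ℰp (ℰp.δ / 2) k ∧
    U ∈ argClassC (S := T3Scales F γ hγ (hγ1.trans (sq_min_one_le _ 𝔠.gamma0_pos)) K) (suGroupModel 2) k ∧
    U ∈ regClassC (S := T3Scales F γ hγ (hγ1.trans (sq_min_one_le _ 𝔠.gamma0_pos)) K) (suGroupModel 2) 𝔠 k h ∧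
    U ∈ AlphaInputsT3AC.large67Set F 𝔠 γ hγ hγ1 K k h ∧
    (ChargedT3 F γ 𝔠.b₀ 𝔠.p₀ (avgWindowFactor F.L) K 𝔠.lane.carrier.M₁
        (rcolOf (T3Scales F γ hγ (hγ1.trans (sq_min_one_le _ 𝔠.gamma0_pos)) K) 𝔠.lane.carrier) k h W →
      U ∈ AlphaInputsT3AC.top42Set F 𝔠 γ hγ hγ1 K k h W ∧ U ∈ AlphaInputsT3AC.reg68LevelsSet F 𝔠 γ hγ hγ1 K k h)}

variable {F 𝔠 γ hγ hγ1 K}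

/-- Unfolding membership in the adapted class. [folklore] -/
theorem AlphaInputsT3AC.mem_adaptedClassT3_iff {k : ℕ} {h : Hist (F.P K) k} {W : GaugeField (F.P K) k (Matrix.specialUnitaryGroup (Fin 2) ℂ)}
    {U : GaugeField (F.P K) 0 (Matrix.specialUnitaryGroup (Fin 2) ℂ)} :
    U ∈ AlphaInputsT3AC.adaptedClassT3 F 𝔠 γ hγ hγ1 K k h W ↔
      U ∈ NestedSmall (P := F.P K) ℰp (ℰp.δ / 2) k ∧
      U ∈ argClassC (S := T3Scales F γ hγ (hγ1.trans (sq_min_one_le _ 𝔠.gamma0_pos)) K) (suGroupModel 2) k ∧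
      U ∈ regClassC (S := T3Scales F γ hγ (hγ1.trans (sq_min_one_le _ 𝔠.gamma0_pos)) K) (suGroupModel 2) 𝔠 k h ∧
      U ∈ AlphaInputsT3AC.large67Set F 𝔠 γ hγ hγ1 K k h ∧
      (ChargedT3 F γ 𝔠.b₀ 𝔠.p₀ (avgWindowFactor F.L) K 𝔠.lane.carrier.M₁
          (rcolOf (T3Scales F γ hγ (hγ1.trans (sq_min_one_le _ 𝔠.gamma0_pos)) K) 𝔠.lane.carrier) k h W →
        U ∈ AlphaInputsT3AC.top42Set F 𝔠 γ hγ hγ1 K k h W ∧ U ∈ AlphaInputsT3AC.reg68LevelsSet F 𝔠 γ hγ hγ1 K k h) :=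
  Iff.rfl

/-! ## §3 Topology: the pieces are closed, the window is open; minimisers and the measurable selector -/

/-- `|· − 1|` is continuous on `SU(2)` (NODE O's `continuous_dist1_rho`; the topology of the realisation `suGroupModel 2` IS the subtype topology). [folklore] -/
theorem AlphaInputsT3AC.continuous_dist1_su2 : Continuous (dist1 : Matrix.specialUnitaryGroup (Fin 2) ℂ → ℝ) :=
  continuous_dist1_rho (suGroupModel 2)

/-- `Re tr` is continuous on `SU(2)`. [folklore] -/
theorem AlphaInputsT3AC.continuous_reTr_su2 : Continuous (reTr : Matrix.specialUnitaryGroup (Fin 2) ℂ → ℝ) :=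
  continuous_reTr_rho (suGroupModel 2)

/-- The Wilson action `A(U) = Σ_p [1 − Re tr U(∂p)]` is continuous on every configuration space `SU(2)^{bonds}`. [cite: Balaban1985Variational, (5) p.278] -/
theorem AlphaInputsT3AC.continuous_wilsonAction4_su2 {P : Params} {j : ℕ} :
    Continuous (fun U : GaugeField P j (Matrix.specialUnitaryGroup (Fin 2) ℂ) => wilsonAction4 U) :=
  continuous_wilsonAction AlphaInputsT3AC.continuous_reTr_su2 1

/-- The small-loop class of the family's averaging is closed (`SubstrateBlockAvgContinuity.isClosed_nestedSmall` at `ℰp`, margin `δ/2 < δ`). [cite: Balaban1987RG1, (0.4) p.253] -/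
theorem AlphaInputsT3AC.isClosed_nestedSmall_ℰp (k : ℕ) : IsClosed (NestedSmall (P := F.P K) ℰp (ℰp.δ / 2) k) :=
  isClosed_nestedSmall ℰp AlphaInputsT3AC.continuous_dist1_su2 smallContinuous_expMeanLogSU (by linarith [ℰp.δ_pos]) k

/-- On the small-loop class of level `k` every `s`-fold average `(blockAvg ℰp)^s`, `s ≤ k`, is continuous. [cite: Balaban1987RG1, (0.4) p.253] -/
theorem AlphaInputsT3AC.continuousOn_iter_ℰp {k s : ℕ} (hs : s ≤ k) :
    ContinuousOn (Averaging.iter (fun l => BlockAveraging.blockAvg (P := F.P K) (j := l) ℰp) s) (NestedSmall (P := F.P K) ℰp (ℰp.δ / 2) k) := by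
  have h := continuousOn_iter_blockAvg (P := F.P K) ℰp AlphaInputsT3AC.continuous_dist1_su2 smallContinuous_expMeanLogSU
    (show ℰp.δ / 2 < ℰp.δ by linarith [ℰp.δ_pos]) s
  refine h.mono ?_
  intro U hU
  induction k, hs using Nat.le_induction with
  | base => exact hU
  | succ k _ ih => exact ih (nestedSmall_succ_subset ℰp _ k hU)

/-- The run's steps are in the periodicity range of the tower: `k ≤ K ⇒ k ≤ m + K + 1`. [folklore] -/
theorem AlphaInputsT3AC.le_period_of_le {m k K : ℕ} (hk : k ≤ K) : k ≤ m + K + 1 := by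
  omega

/-- On NODE O's open adapted class of level `k`, the holonomy of every word in the lifted `j`-fold average, `j < k`, is continuous (bond variables by
`continuousAt_val_liftAvg`, words by `continuousAt_val_hol`). [cite: Balaban1985Averaging, (42)–(43) pp.23–24] -/
theorem AlphaInputsT3AC.continuousOn_val_hol_liftAvg {j k : ℕ} (hjk : j < k) (y : B7Prop1Explicit.Site (F.P K).d) (w : List (B7Prop1Explicit.Letter (F.P K).d)) :
    ContinuousOn (fun U : GaugeField (F.P K) 0 (Matrix.specialUnitaryGroup (Fin 2) ℂ) =>
      ((hol (avgIter F.L (liftCfg (S := T3Scales F γ hγ (hγ1.trans (sq_min_one_le _ 𝔠.gamma0_pos)) K) (suGroupModel 2) U) j) y w :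
        (Matrix (Fin (suGroupModel 2).N) (Fin (suGroupModel 2).N) ℂ)ˣ) : Matrix (Fin (suGroupModel 2).N) (Fin (suGroupModel 2).N) ℂ))
      (argClass (S := T3Scales F γ hγ (hγ1.trans (sq_min_one_le _ 𝔠.gamma0_pos)) K) (suGroupModel 2) k) := by
  refine continuousOn_of_forall_continuousAt fun U₀ hU₀ => ?_
  have hb := continuousAt_val_liftAvg (S := T3Scales F γ hγ (hγ1.trans (sq_min_one_le _ 𝔠.gamma0_pos)) K) (suGroupModel 2) j U₀
    (fun i' hi' q κ' r => (hU₀ i' (hi'.trans hjk) q κ' r).trans (by norm_num))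
  exact continuousAt_val_hol (F := fun U : GaugeField (F.P K) 0 (Matrix.specialUnitaryGroup (Fin 2) ℂ) =>
    avgIter F.L (liftCfg (S := T3Scales F γ hγ (hγ1.trans (sq_min_one_le _ 𝔠.gamma0_pos)) K) (suGroupModel 2) U) j) hb y w

/-- A closed set cut by finitely indexed conditions, each closed RELATIVE to it, is closed. [folklore] -/
theorem AlphaInputsT3AC.isClosed_inter_setOf_forall {α ι : Type*} [TopologicalSpace α] {A : Set α} (hA : IsClosed A) (s : Finset ι)
    {P : ι → α → Prop} (h : ∀ i ∈ s, IsClosed (A ∩ {x | P i x})) : IsClosed (A ∩ {x | ∀ i ∈ s, P i x}) := by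
  have hset : A ∩ {x | ∀ i ∈ s, P i x} = A ∩ ⋂ i ∈ s, (A ∩ {x | P i x}) := by
    ext x
    simp only [mem_inter_iff, mem_setOf_eq, mem_iInter]
    exact ⟨fun hx => ⟨hx.1, fun i hi => ⟨hx.1, hx.2 i hi⟩⟩, fun hx => ⟨hx.1, fun i hi => (hx.2 i hi).2⟩⟩
  rw [hset]
  exact hA.inter (isClosed_biInter h)

/-- One (67)-condition is closed relative to NODE O's closed adapted class `argClassC 𝔊 k` when its scale is `< k ≤ K` (a `≤` between a constant and a map
continuous on the open class ⊇ the closed one). [cite: Balaban1985UV3, (67) p.273] -/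
theorem AlphaInputsT3AC.isClosed_argClassC_inter_large67_one {k : ℕ} (hk : k ≤ K) {j : ℕ} (hjk : j < k) (c : ℝ)
    (y : B7Prop1Explicit.Site (F.P K).d) (w : List (B7Prop1Explicit.Letter (F.P K).d)) :
    IsClosed (argClassC (S := T3Scales F γ hγ (hγ1.trans (sq_min_one_le _ 𝔠.gamma0_pos)) K) (suGroupModel 2) k ∩
      {U | c ≤ ‖((hol (avgIter F.L (liftCfg (S := T3Scales F γ hγ (hγ1.trans (sq_min_one_le _ 𝔠.gamma0_pos)) K) (suGroupModel 2) U) j) y w :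
        (Matrix (Fin (suGroupModel 2).N) (Fin (suGroupModel 2).N) ℂ)ˣ) : Matrix (Fin (suGroupModel 2).N) (Fin (suGroupModel 2).N) ℂ) - 1‖}) := by
  have hC := isClosed_argClassC (S := T3Scales F γ hγ (hγ1.trans (sq_min_one_le _ 𝔠.gamma0_pos)) K) (suGroupModel 2) k
    (AlphaInputsT3AC.le_period_of_le (m := F.m) hk)
  have hsub := argClassC_subset_argClass (S := T3Scales F γ hγ (hγ1.trans (sq_min_one_le _ 𝔠.gamma0_pos)) K) (suGroupModel 2) k
  have hcont : ContinuousOn (fun U : GaugeField (F.P K) 0 (Matrix.specialUnitaryGroup (Fin 2) ℂ) =>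
      ‖((hol (avgIter F.L (liftCfg (S := T3Scales F γ hγ (hγ1.trans (sq_min_one_le _ 𝔠.gamma0_pos)) K) (suGroupModel 2) U) j) y w :
        (Matrix (Fin (suGroupModel 2).N) (Fin (suGroupModel 2).N) ℂ)ˣ) : Matrix (Fin (suGroupModel 2).N) (Fin (suGroupModel 2).N) ℂ) - 1‖)
      (argClassC (S := T3Scales F γ hγ (hγ1.trans (sq_min_one_le _ 𝔠.gamma0_pos)) K) (suGroupModel 2) k) :=
    (((AlphaInputsT3AC.continuousOn_val_hol_liftAvg (F := F) (𝔠 := 𝔠) (γ := γ) (hγ := hγ) (hγ1 := hγ1) (K := K) hjk y w).mono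
      hsub).sub (continuousOn_const (c := (1 : Matrix (Fin (suGroupModel 2).N) (Fin (suGroupModel 2).N) ℂ)))).norm
  exact hcont.preimage_isClosed_of_isClosed hC isClosed_Ici

/-- The (67)-largeness set is closed relative to `argClassC 𝔊 k`, `k ≤ K`. [cite: Balaban1985UV3, (67) p.273] -/
theorem AlphaInputsT3AC.isClosed_argClassC_inter_large67Set {k : ℕ} (hk : k ≤ K) (h : Hist (F.P K) k) :
    IsClosed (argClassC (S := T3Scales F γ hγ (hγ1.trans (sq_min_one_le _ 𝔠.gamma0_pos)) K) (suGroupModel 2) k ∩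
      AlphaInputsT3AC.large67Set F 𝔠 γ hγ hγ1 K k h) := by
  refine AlphaInputsT3AC.isClosed_inter_setOf_forall
    (isClosed_argClassC (S := T3Scales F γ hγ (hγ1.trans (sq_min_one_le _ 𝔠.gamma0_pos)) K) (suGroupModel 2) k
      (AlphaInputsT3AC.le_period_of_le (m := F.m) hk)) (Hist.disc h) fun e he => ?_
  obtain ⟨j, hj, p, -, hqj, -, -, -⟩ := decode_of_mem_disc (S := T3Scales F γ hγ (hγ1.trans (sq_min_one_le _ 𝔠.gamma0_pos)) K) he
  have hjk : e.1 < k := by rw [hqj]; exact hj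
  exact AlphaInputsT3AC.isClosed_argClassC_inter_large67_one (𝔠 := 𝔠) (hγ1 := hγ1) hk hjk _ _ _

/-- A closed set cut by an implication-guarded family of conditions, each closed RELATIVE to it, is closed. [folklore] -/
theorem AlphaInputsT3AC.isClosed_inter_setOf_forall_imp {ι : Sort*} {β : Type*} [TopologicalSpace β] {A : Set β} (hA : IsClosed A)
    {p : ι → Prop} {P : ι → β → Prop} (h : ∀ i, p i → IsClosed (A ∩ {x | P i x})) : IsClosed (A ∩ {x | ∀ i, p i → P i x}) := by
  have hset : A ∩ {x | ∀ i, p i → P i x} = A ∩ ⋂ i, ⋂ (_ : p i), (A ∩ {x | P i x}) := by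
    ext x
    simp only [mem_inter_iff, mem_setOf_eq, mem_iInter]
    exact ⟨fun hx => ⟨hx.1, fun i hi => ⟨hx.1, hx.2 i hi⟩⟩, fun hx => ⟨hx.1, fun i hi => (hx.2 i hi).2⟩⟩
  rw [hset]
  exact hA.inter (isClosed_iInter fun i => isClosed_iInter fun hi => h i hi)

/-- One r3-condition is closed relative to the small-loop class of level `k`: `dist1 ∘ plaqHol_q ∘ (blockAvg ℰp)^s`, `s ≤ k`, is continuous there.
[cite: Balaban1985UV3, (68) p.273] -/
theorem AlphaInputsT3AC.isClosed_nestedSmall_inter_reg68_one {k s : ℕ} (hs : s ≤ k) (q : Plaq (F.P K) s) (c : ℝ) :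
    IsClosed (NestedSmall (P := F.P K) ℰp (ℰp.δ / 2) k ∩
      {U | GaugeGroup.dist1 (GaugeField.plaqHol (Averaging.iter (fun l => BlockAveraging.blockAvg (P := F.P K) (j := l) ℰp) s U) q) ≤ c}) := by
  have hcont : ContinuousOn (fun U : GaugeField (F.P K) 0 (Matrix.specialUnitaryGroup (Fin 2) ℂ) =>
      GaugeGroup.dist1 (GaugeField.plaqHol (Averaging.iter (fun l => BlockAveraging.blockAvg (P := F.P K) (j := l) ℰp) s U) q))
      (NestedSmall (P := F.P K) ℰp (ℰp.δ / 2) k) :=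
    (AlphaInputsT3AC.continuous_dist1_su2.comp (continuous_plaqHol q)).comp_continuousOn (AlphaInputsT3AC.continuousOn_iter_ℰp hs)
  exact hcont.preimage_isClosed_of_isClosed (AlphaInputsT3AC.isClosed_nestedSmall_ℰp k) isClosed_Iic

/-- The r3 multi-level regularity set is closed relative to the small-loop class `NestedSmall ℰp (δ/2) k`. [cite: Balaban1985UV3, (68) p.273] -/
theorem AlphaInputsT3AC.isClosed_nestedSmall_inter_reg68LevelsSet (k : ℕ) (h : Hist (F.P K) k) :
    IsClosed (NestedSmall (P := F.P K) ℰp (ℰp.δ / 2) k ∩ AlphaInputsT3AC.reg68LevelsSet F 𝔠 γ hγ hγ1 K k h) := by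
  refine AlphaInputsT3AC.isClosed_inter_setOf_forall_imp (AlphaInputsT3AC.isClosed_nestedSmall_ℰp k) fun i hi => ?_
  refine AlphaInputsT3AC.isClosed_inter_setOf_forall_imp (AlphaInputsT3AC.isClosed_nestedSmall_ℰp k) fun s hs => ?_
  refine AlphaInputsT3AC.isClosed_inter_setOf_forall_imp (AlphaInputsT3AC.isClosed_nestedSmall_ℰp k) fun q _ => ?_
  exact AlphaInputsT3AC.isClosed_nestedSmall_inter_reg68_one (hs.trans hi) q _

/-- **THE WINDOW IS OPEN**: for a fixed history, the set of CHARGED data `{W | ChargedT3 … k h W}` is open in `SU(2)^{bonds}` (finitely many strict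
plaquette inequalities; the admissibility conjunct does not depend on `W`). [cite: Balaban1985UV3, (40) p.266] -/
theorem AlphaInputsT3AC.isOpen_chargedT3 (k : ℕ) (h : Hist (F.P K) k) :
    IsOpen {W : GaugeField (F.P K) k (Matrix.specialUnitaryGroup (Fin 2) ℂ) |
      ChargedT3 F γ 𝔠.b₀ 𝔠.p₀ (avgWindowFactor F.L) K 𝔠.lane.carrier.M₁
        (rcolOf (T3Scales F γ hγ (hγ1.trans (sq_min_one_le _ 𝔠.gamma0_pos)) K) 𝔠.lane.carrier) k h W} := by
  by_cases hh : Hist.Admissible 𝔠.lane.carrier.M₁ (rcolOf (T3Scales F γ hγ (hγ1.trans (sq_min_one_le _ 𝔠.gamma0_pos)) K) 𝔠.lane.carrier) k h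
  · have hset : {W : GaugeField (F.P K) k (Matrix.specialUnitaryGroup (Fin 2) ℂ) |
        ChargedT3 F γ 𝔠.b₀ 𝔠.p₀ (avgWindowFactor F.L) K 𝔠.lane.carrier.M₁
          (rcolOf (T3Scales F γ hγ (hγ1.trans (sq_min_one_le _ 𝔠.gamma0_pos)) K) 𝔠.lane.carrier) k h W} =
        {W | ∀ p ∈ (↑(plaqsIn k (Omega 𝔠.lane.carrier.M₁
            (rcolOf (T3Scales F γ hγ (hγ1.trans (sq_min_one_le _ 𝔠.gamma0_pos)) K) 𝔠.lane.carrier) k h k)) : Set (Plaq (F.P K) k)),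
          GaugeGroup.dist1 (GaugeField.plaqHol W p) < (fun _ => 2 * (F.L : ℝ) ^ 2 * avgWindowFactor F.L * θBal F.L γ 𝔠.b₀ 𝔠.p₀ (K - k + 1)) p} := by
      ext W
      simp only [ChargedT3, PlaqSmallOn, mem_setOf_eq]
      exact ⟨fun hW => hW.2, fun hW => ⟨hh, hW⟩⟩
    rw [hset]
    exact isOpen_plaqSmallClass AlphaInputsT3AC.continuous_dist1_su2 _ _
  · have hset : {W : GaugeField (F.P K) k (Matrix.specialUnitaryGroup (Fin 2) ℂ) |
        ChargedT3 F γ 𝔠.b₀ 𝔠.p₀ (avgWindowFactor F.L) K 𝔠.lane.carrier.M₁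
          (rcolOf (T3Scales F γ hγ (hγ1.trans (sq_min_one_le _ 𝔠.gamma0_pos)) K) 𝔠.lane.carrier) k h W} = ∅ := by
      ext W
      simp only [ChargedT3, mem_setOf_eq, mem_empty_iff_false, iff_false, not_and]
      exact fun h' => absurd h' hh
    rw [hset]
    exact isOpen_empty

/-- **THE W-INDEPENDENT PART OF THE CLASS IS CLOSED**: small-loop classes ∩ closed regular class ∩ (67)-largeness, `k ≤ K`. [cite: Balaban1985UV3, (67)–(68) p.273] -/
theorem AlphaInputsT3AC.isClosed_adaptedCore {k : ℕ} (hk : k ≤ K) (h : Hist (F.P K) k) :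
    IsClosed (NestedSmall (P := F.P K) ℰp (ℰp.δ / 2) k ∩
      (argClassC (S := T3Scales F γ hγ (hγ1.trans (sq_min_one_le _ 𝔠.gamma0_pos)) K) (suGroupModel 2) k ∩
        AlphaInputsT3AC.large67Set F 𝔠 γ hγ hγ1 K k h) ∩
      regClassC (S := T3Scales F γ hγ (hγ1.trans (sq_min_one_le _ 𝔠.gamma0_pos)) K) (suGroupModel 2) 𝔠 k h) :=
  ((AlphaInputsT3AC.isClosed_nestedSmall_ℰp k).inter (AlphaInputsT3AC.isClosed_argClassC_inter_large67Set (𝔠 := 𝔠) (hγ1 := hγ1) hk h)).inter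
    (isClosed_regClassC (S := T3Scales F γ hγ (hγ1.trans (sq_min_one_le _ 𝔠.gamma0_pos)) K) (suGroupModel 2) 𝔠 k h)

end T3

end Summit.QuantumFields.YangMills.Theorems

end
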